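import Mathlib
import Summits.PneNP.PneNP.Theses.AeaCutRectangles
import Summits.PneNP.PneNP.Theorems.FoolingMeasure.Negative.FoolingMeasureFalseOfHalfSparseCore

/-!
# Sketch (crux-ideate round 2, seat 2, g2) — rounding-defect criticality and the S1(a) object

First lemmas for the crux idea card `rounding-defect-criticality` on `stmt-PneNP-19727`
(`Summit.PneNP.PneNP.Theses.AeaCutRectangles.FoolingMeasure`).  Restricted-model rung; nothing here bears on P vs NP.
-/

namespace Summit.PneNP.PneNP.Cruxes.FoolingMeasure.IdeasR2g2

open Finset
open Summit.PneNP.PneNP.Theorems.AeaCutRectanglesDutyRectangles (bobSide)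
open Summit.PneNP.PneNP.Theorems.FoolingMeasure.Negative (HalfSparseCore)

/-- 3-colourability of the graph spanned by an edge set over `Fin n` (as in the route file). -/
abbrev Col3 {n : ℕ} (G : Finset (Sym2 (Fin n))) : Prop :=
  (SimpleGraph.fromEdgeSet (G : Set (Sym2 (Fin n)))).Colorable 3

/-- **S1(a) object / TE instance**: a loopless, 4-edge-critical edge set on `Fin n` in which every vertex set of
size `≥ n/2` spans MORE than `n/2` of its edges ("half-dense critical", HDC). -/
def HDCritical (n : ℕ) (G : Finset (Sym2 (Fin n))) : Prop :=
  (∀ e ∈ G, ¬ e.IsDiag) ∧ ¬ Col3 G ∧ (∀ e ∈ G, Col3 (G.erase e)) ∧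
    ∀ S : Finset (Fin n), n ≤ 2 * S.card → n < 2 * (bobSide S G).card

/-- One HDC 4-critical graph refutes `HalfSparseCore`, the hypothesis of the landed conditional refutation
`foolingMeasure_false_of_halfSparseCore` (p570033): inside a critical `G` the only non-3-colourable `F ⊆ G` is
`G` itself, whose halves are all dense. -/
theorem not_halfSparseCore_of_hdCritical {n : ℕ} {G : Finset (Sym2 (Fin n))} (h : HDCritical n G) :
    ¬ HalfSparseCore := by
  intro hH
  obtain ⟨hloop, hnc, hcrit, hdense⟩ := h
  obtain ⟨S, hS, F, hFG, hF, hsparse⟩ := hH n G hloop hnc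
  have hFG' : F = G := by
    by_contra hne
    obtain ⟨e, heG, heF⟩ : ∃ e ∈ G, e ∉ F := by
      by_contra h'
      push_neg at h'
      exact hne (Finset.Subset.antisymm hFG h')
    have hsub : F ⊆ G.erase e := fun x hx =>
      Finset.mem_erase.2 ⟨fun h => heF (h ▸ hx), hFG hx⟩
    apply hF
    exact (hcrit e heG).mono_left (SimpleGraph.fromEdgeSet_mono (Finset.coe_subset.2 hsub))
  subst hFG'
  exact absurd (hdense S hS) (not_lt.2 hsparse)

/-! ### The rounding-defect recipe on `ZMod (3q+1)` -/

/-- Arc colouring of `ZMod (3q+1)`: `[0,q) ↦ 0`, `[q,2q) ↦ 1`, `[2q,3q] ↦ 2`. -/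
def arcColour (q : ℕ) (x : ZMod (3 * q + 1)) : Fin 3 :=
  if x.val < q then 0 else if x.val < 2 * q then 1 else 2

/-- A middle-third length `L ∈ [q+1, 2q]` never joins two points of the same arc. -/
def MiddleThirdProper (q : ℕ) : Prop :=
  ∀ L : ℕ, q + 1 ≤ L → L ≤ 2 * q →
    ∀ x y : ZMod (3 * q + 1),
      (SimpleGraph.circulantGraph {(L : ZMod (3 * q + 1)), -(L : ZMod (3 * q + 1))}).Adj x y →
        arcColour q x ≠ arcColour q y

/-- The tight length `q` (≡ `-(2q+1)`) has exactly ONE monochromatic edge under the arc colouring: `{2q, 3q}`. -/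
def TightLengthSingleDefect (q : ℕ) : Prop :=
  ∀ x y : ZMod (3 * q + 1),
    (SimpleGraph.circulantGraph {(q : ZMod (3 * q + 1)), -(q : ZMod (3 * q + 1))}).Adj x y →
      arcColour q x = arcColour q y →
        s(x, y) = s((((2 * q : ℕ)) : ZMod (3 * q + 1)), (((3 * q : ℕ)) : ZMod (3 * q + 1)))

/-- **Ratio clique**: `1 ∈ U ⊆ (ZMod n)ˣ` and every ratio `v/u` (`u ≠ v` in `U`) has least residue `≡ 2 (mod 3)`.
(Equivalently `q·(v/u) mod n ∈ [q+1, 2q]`, since `q ≡ -3⁻¹` and `3·[q+1,2q] = {x ≡ 2 mod 3}`.) -/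
def RatioClique (q : ℕ) (U : Finset (ZMod (3 * q + 1))) : Prop :=
  (1 : ZMod (3 * q + 1)) ∈ U ∧ (∀ u ∈ U, IsUnit u) ∧
    ∀ u ∈ U, ∀ v ∈ U, u ≠ v → (v * u⁻¹).val % 3 = 2

/-- Connection set `± q·U`. -/
def rdConnection (q : ℕ) (U : Finset (ZMod (3 * q + 1))) : Set (ZMod (3 * q + 1)) :=
  {x | ∃ u ∈ U, x = (q : ZMod (3 * q + 1)) * u ∨ x = -((q : ZMod (3 * q + 1)) * u)}

/-- The rounding-defect circulant `C_n(± qU)`, `n = 3q+1`. -/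
def rdGraph (q : ℕ) (U : Finset (ZMod (3 * q + 1))) : SimpleGraph (ZMod (3 * q + 1)) :=
  SimpleGraph.circulantGraph (rdConnection q U)

/-- **THE RECIPE (first lemma of the card, size M)**: in a ratio-clique circulant EVERY edge is critical —
for the class of `q·uᵢ` compose the arc colouring with the unit multiplier `uᵢ⁻¹` (a graph automorphism onto
`C_n(± q·U/uᵢ)`, whose lengths are `q` once and middle-third otherwise), then translate the single defect onto
the chosen edge.  Proof ingredients: `MiddleThirdProper`, `TightLengthSingleDefect`, multiplier automorphisms
of circulants, vertex-transitivity. -/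
def RoundingDefectCritical (q : ℕ) (U : Finset (ZMod (3 * q + 1))) : Prop :=
  RatioClique q U → ∀ x y, (rdGraph q U).Adj x y → ((rdGraph q U).deleteEdges {s(x, y)}).Colorable 3

/-- Corollary form used by the census: a ratio-clique circulant is 4-critical iff it is not 3-colourable
(it is always 4-colourable: arc colouring plus one recoloured vertex). -/
def RecipeDichotomy (q : ℕ) (U : Finset (ZMod (3 * q + 1))) : Prop :=
  RatioClique q U → (rdGraph q U).Colorable 4 ∧
    (¬ (rdGraph q U).Colorable 3 → ∀ x y, (rdGraph q U).Adj x y → ((rdGraph q U).deleteEdges {s(x, y)}).Colorable 3)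

/-- The two data points the recipe explains (TE-CENSUS C1): `C(13;1,5) ≅ C₁₃(±4·{1,5})` and
`C(97;1,11,38) ≅ C₉₇(±32·{1,11,38})` are ratio-clique circulants (`q = 4`, `U = {1,5}`; `q = 32`, `U = {1,11,38}`). -/
def KnownInstances : Prop :=
  RatioClique 4 ({1, 5} : Finset (ZMod 13)) ∧ RatioClique 32 ({1, 11, 38} : Finset (ZMod 97))

/-- sanity (n = 13): `8 = 5⁻¹` in `ZMod 13`, and both `5` and `8` have least residue `≡ 2 (mod 3)`. -/
example : ((5 : ZMod 13) * 8).val = 1 ∧ (5 : ZMod 13).val % 3 = 2 ∧ (8 : ZMod 13).val % 3 = 2 := by decide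


/-! ### Half-density certificates for circulants (the "odd-relation / metric LP" engine)

For `S ⊆ ZMod n` and a shift `x`, `differ S x` counts the positions where `1_S` and its `x`-translate disagree.
The two elementary inequalities below (subadditivity and parity) are the atoms of every certificate:
any odd relation `∑ cᵢ Lᵢ = 0` (`∑ |cᵢ|` odd) among the lengths yields `∑ |cᵢ| · agree S Lᵢ ≥ n`, and
`2 · e_L(S) + differ S L = 2 · |S|` converts agreement into inner edge counts.  (Statements only.) -/

/-- number of `v` with `1_S(v) ≠ 1_S(v + x)` -/
def differ {n : ℕ} [NeZero n] (S : Finset (ZMod n)) (x : ZMod n) : ℕ :=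
  (Finset.univ.filter fun v : ZMod n => ¬ (v ∈ S ↔ v + x ∈ S)).card

/-- subadditivity: near-periods compose (`δ(x+y) ≤ δ(x) + δ(y)`). -/
def DifferSubadditive : Prop :=
  ∀ (n : ℕ) [NeZero n] (S : Finset (ZMod n)) (x y : ZMod n), differ S (x + y) ≤ differ S x + differ S y

/-- parity: around every triangle `v, v+x, v+x+y` the number of disagreements is even, hence `≤ 2`
(`δ(x) + δ(y) + δ(x+y) ≤ 2n`; equivalently near-ANTI-periods compose to near-periods). -/
def DifferParity : Prop :=
  ∀ (n : ℕ) [NeZero n] (S : Finset (ZMod n)) (x y : ZMod n), differ S x + differ S y + differ S (x + y) ≤ 2 * n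

/-- edge count of one length class inside `S`: `2·#{v ∈ S : v + L ∈ S} + δ(L) = 2|S|`. -/
def InnerEdgesOfDiffer : Prop :=
  ∀ (n : ℕ) [NeZero n] (S : Finset (ZMod n)) (L : ZMod n),
    2 * (S.filter fun v => v + L ∈ S).card + differ S L = 2 * S.card

/-- **Odd-relation certificate** (consequence of the three atoms): if the lengths admit a relation
`∑ cᵢ Lᵢ = 0` in `ZMod n` with `∑ |cᵢ|` odd, then `∑ |cᵢ| · (n − differ S Lᵢ) ≥ n` for every `S`.
With `±1` coefficients on an odd subset this alone forces every half of `C_n(±D)` to span `≥ (n + t)/2`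
edges; in general the translation-symmetrised metric LP over all such relations is the certificate
(kit j292753). -/
def OddRelationCertificate : Prop :=
  ∀ (n : ℕ) [NeZero n] (t : ℕ) (L : Fin t → ZMod n) (c : Fin t → ℤ) (S : Finset (ZMod n)),
    (∑ i, c i • L i) = 0 → Odd (∑ i, (c i).natAbs) →
      n ≤ ∑ i, (c i).natAbs * (n - differ S (L i))

/-! ### The DMP instance `C(12025; 1, 563, 566, 1727, 3632, 4586)` and its six-relation half-density certificate

Dobrynin–Mel'nikov–Pyatkin (Diskretn. Anal. Issled. Oper. Ser. 1, 10:3 (2003) 12–22, Appendix 1, r = 12, no. 25) prove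
this 12-regular circulant 4-critical (normal circulant + periodicity relation `566 = 563 + 3` + their Lemma 3).
The six odd relations below hold among its lengths; by the walk-parity lemma each gives
`∑ |cᵢ| · agree S Lᵢ ≥ n`, and with weights `5/18, 2/9, 5/18, 2/9, 1/18, 1/18` every length receives total
coefficient exactly `1`, so `9 · ∑_L agree S L ≥ 10 · n` for EVERY `S`, whence every `S` with `|S| ≥ n/2`
spans `≥ 6684 > n/2` edges (`2e(S) = ∑_L agree S L − 6n + 12|S|`).  Statements only; arithmetic checked. -/

/-- number of `v` with `1_S(v) = 1_S(v + x)` (agreements of `1_S` with its `x`-translate). -/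
def agree {n : ℕ} [NeZero n] (S : Finset (ZMod n)) (x : ZMod n) : ℕ :=
  (Finset.univ.filter fun v : ZMod n => (v ∈ S ↔ v + x ∈ S)).card

/-- **Walk parity** (the one general lemma the certificate needs): along a closed walk with an odd number of
steps the indicator `1_S` cannot alternate at every step, so summing over all start points,
`∑ⱼ agree S (stepⱼ) ≥ n` whenever the steps sum to `0` and their number is odd. -/
def WalkParity : Prop :=
  ∀ (n : ℕ) [NeZero n] (S : Finset (ZMod n)) (l : List (ZMod n)), l.sum = 0 → Odd l.length →
    n ≤ (l.map (agree S)).sum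

/-- inner edges of the circulant `C_n(±D)` on a vertex set `S`, counted class by class. -/
def innerEdges {n : ℕ} [NeZero n] (D : Finset (ZMod n)) (S : Finset (ZMod n)) : ℕ :=
  ∑ L ∈ D, (S.filter fun v => v + L ∈ S).card

/-- the DMP lengths (Appendix 1, r = 12, no. 25). -/
def dmp25 : Finset (ZMod 12025) := {1, 563, 566, 1727, 3632, 4586}

/-- the six odd relations (heights 5,5,5,5,9,9); integer identities, hence identities in `ZMod 12025`. -/
example : (2 * 566 + 2 * 1727 : ℤ) = 4586 ∧ (3 * 1 + 563 : ℤ) = 566 ∧ (2 * 563 + 1727 + 2 * 4586 : ℤ) = 12025 ∧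
    (563 + 566 + 3 * 3632 : ℤ) = 12025 ∧ (3 * 1 + 3 * 3632 : ℤ) = 1727 + 2 * 4586 ∧
    (3 * 1 + 2 * 1727 + 12025 : ℤ) = 3 * 3632 + 4586 := by norm_num

/-- the dual weights put total coefficient exactly `1` on every length (so the weighted sum of the six
walk-parity inequalities is `∑_L agree S L ≥ (10/9)·n`); checked over `ℚ`, one conjunct per length
`1, 563, 566, 1727, 3632, 4586`. -/
example : (3 * (2/9 : ℚ) + 3 * (1/18) + 3 * (1/18) = 1) ∧ ((2/9 : ℚ) + 2 * (5/18) + 2/9 = 1) ∧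
    (2 * (5/18 : ℚ) + 2/9 + 2/9 = 1) ∧ (2 * (5/18 : ℚ) + 5/18 + 1/18 + 2 * (1/18) = 1) ∧
    (3 * (2/9 : ℚ) + 3 * (1/18) + 3 * (1/18) = 1) ∧ ((5/18 : ℚ) + 2 * (5/18) + 2 * (1/18) + 1/18 = 1) ∧
    ((5/18 : ℚ) + 2/9 + 5/18 + 2/9 + 1/18 + 1/18 = 10/9) := by norm_num

/-- **Certificate consequence** for the instance: every vertex set agrees with its six translates at least
`(10/9)·n` times in total. (Follows from `WalkParity` applied to the six relations; statement only.) -/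
def C12025AgreeBound : Prop :=
  ∀ S : Finset (ZMod 12025), 10 * 12025 ≤ 9 * ∑ L ∈ dmp25, agree S L

/-- **Half-density of the DMP instance**: every `S` with `|S| ≥ n/2` spans at least `6684 > 6012 = ⌊n/2⌋`
edges of `C(12025; ±dmp25)` — i.e. the graph has NO sparse half.  With 4-criticality (DMP 2003) this is an
`HDCritical` instance and refutes `HalfSparseCore` via `not_halfSparseCore_of_hdCritical`. -/
def C12025HalfDense : Prop :=
  ∀ S : Finset (ZMod 12025), 12025 ≤ 2 * S.card → 6684 ≤ innerEdges dmp25 S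

/-- the same certificate is PARAMETRIC: for lengths `(1, a, a+3, b, c, d)` with `d = 2a + 2b + 6`,
`n = 6a + 5b + 12`, `3c = 4a + 5b + 9` the six relations hold identically (DMP no. 25: `a=563, b=1727`;
no. 30: `a=959, b=1799`, `n = 14761`), so every member of the family satisfies `∑_L agree S L ≥ (10/9)n`. -/
example (a b c d n : ℤ) (hd : d = 2*a + 2*b + 6) (hn : n = 6*a + 5*b + 12) (hc : 3*c = 4*a + 5*b + 9) :
    2*(a+3) + 2*b = d ∧ 3*1 + a = a + 3 ∧ 2*a + b + 2*d = n ∧ a + (a+3) + 3*c = n ∧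
    3*1 + 3*c = b + 2*d ∧ 3*1 + 2*b + n = 3*c + d := by
  refine ⟨by omega, by omega, by omega, by omega, by omega, by omega⟩

/-! ### Proof of `WalkParity` and of the instance bound `C12025AgreeBound` -/

section WalkParityProof
variable {n : ℕ} [NeZero n]

/-- agreements collected along the walk `v, v+x₁, v+x₁+x₂, …`. -/
def walkAgree (S : Finset (ZMod n)) : ZMod n → List (ZMod n) → ℕ
  | _, [] => 0
  | v, (x :: xs) => (if (v ∈ S ↔ v + x ∈ S) then 1 else 0) + walkAgree S (v + x) xs

theorem agree_eq_sum (S : Finset (ZMod n)) (x : ZMod n) :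
    agree S x = ∑ v : ZMod n, (if (v ∈ S ↔ v + x ∈ S) then 1 else 0) := by
  unfold agree; rw [Finset.card_filter]

theorem agree_neg (S : Finset (ZMod n)) (x : ZMod n) : agree S (-x) = agree S x := by
  rw [agree_eq_sum, agree_eq_sum,
    ← Equiv.sum_comp (Equiv.addRight x) (fun v => if (v ∈ S ↔ v + -x ∈ S) then 1 else 0)]
  refine Finset.sum_congr rfl fun w _ => ?_
  simp only [Equiv.coe_addRight, add_neg_cancel_right]
  by_cases h1 : w ∈ S <;> by_cases h2 : w + x ∈ S <;> simp [h1, h2]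

theorem sum_map_agree_eq (S : Finset (ZMod n)) :
    ∀ l : List (ZMod n), (l.map (agree S)).sum = ∑ v : ZMod n, walkAgree S v l
  | [] => by simp [walkAgree]
  | (x :: xs) => by
      simp only [List.map_cons, List.sum_cons, walkAgree]
      rw [Finset.sum_add_distrib, sum_map_agree_eq S xs, agree_eq_sum]
      congr 1
      exact (Equiv.sum_comp (Equiv.addRight x) (fun v => walkAgree S v xs)).symm

theorem walkAgree_parity (S : Finset (ZMod n)) :
    ∀ (l : List (ZMod n)) (v : ZMod n), walkAgree S v l = 0 →
      ((v ∈ S ↔ v + l.sum ∈ S) ↔ Even l.length)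
  | [], v, _ => by simp
  | (x :: xs), v, h => by
      by_cases hc : (v ∈ S ↔ v + x ∈ S)
      · simp [walkAgree, hc] at h
      · have h2 : walkAgree S (v + x) xs = 0 := by simpa [walkAgree, hc] using h
        have ih := walkAgree_parity S xs (v + x) h2
        simp only [List.sum_cons, List.length_cons, Nat.even_add_one]
        rw [← add_assoc]
        tauto

/-- **`WalkParity` holds.** -/
theorem walkParity_holds : WalkParity := by
  intro n _ S l hsum hodd
  have key : ∀ v : ZMod n, 1 ≤ walkAgree S v l := by
    intro v
    by_contra hv
    have h0 : walkAgree S v l = 0 := by omega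
    have hp := walkAgree_parity S l v h0
    rw [hsum, add_zero] at hp
    exact (Nat.not_even_iff_odd.mpr hodd) (hp.mp Iff.rfl)
  calc n = ∑ _v : ZMod n, 1 := by simp [ZMod.card]
    _ ≤ ∑ v : ZMod n, walkAgree S v l := Finset.sum_le_sum fun v _ => key v
    _ = (l.map (agree S)).sum := (sum_map_agree_eq S l).symm

end WalkParityProof

theorem sum_dmp25 (f : ZMod 12025 → ℕ) :
    ∑ L ∈ dmp25, f L = f 1 + (f 563 + (f 566 + (f 1727 + (f 3632 + f 4586)))) := by
  rw [dmp25, Finset.sum_insert (by decide), Finset.sum_insert (by decide), Finset.sum_insert (by decide),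
    Finset.sum_insert (by decide), Finset.sum_insert (by decide), Finset.sum_singleton]

/-- **`C12025AgreeBound` holds**: the six-relation certificate, kernel-checked. -/
theorem c12025AgreeBound_holds : C12025AgreeBound := by
  intro S
  have W := @walkParity_holds
  have r1 := W 12025 S [566, 566, 1727, 1727, -4586] (by decide) (by decide)
  have r2 := W 12025 S [1, 1, 1, 563, -566] (by decide) (by decide)
  have r3 := W 12025 S [563, 563, 1727, 4586, 4586] (by decide) (by decide)
  have r4 := W 12025 S [563, 566, 3632, 3632, 3632] (by decide) (by decide)
  have r5 := W 12025 S [1, 1, 1, -1727, 3632, 3632, 3632, -4586, -4586] (by decide) (by decide)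
  have r6 := W 12025 S [1, 1, 1, 1727, 1727, -3632, -3632, -3632, -4586] (by decide) (by decide)
  simp only [List.map_cons, List.map_nil, List.sum_cons, List.sum_nil, agree_neg] at r1 r2 r3 r4 r5 r6
  rw [sum_dmp25]
  omega

/-! ### From agreements to inner edges, and `C12025HalfDense` -/

section InnerEdges
variable {n : ℕ} [NeZero n]

theorem sum_ite_mem_eq_card (S : Finset (ZMod n)) :
    ∑ v : ZMod n, (if v ∈ S then 1 else 0) = S.card := by
  rw [Finset.sum_boole]; simp

theorem sum_ite_mem_shift_eq_card (S : Finset (ZMod n)) (L : ZMod n) :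
    ∑ v : ZMod n, (if v + L ∈ S then 1 else 0) = S.card := by
  rw [← sum_ite_mem_eq_card S]
  exact Equiv.sum_comp (Equiv.addRight L) (fun v => if v ∈ S then 1 else 0)

theorem sum_ite_and_eq_card (S : Finset (ZMod n)) (L : ZMod n) :
    ∑ v : ZMod n, (if (v ∈ S ∧ v + L ∈ S) then 1 else 0) = (S.filter fun v => v + L ∈ S).card := by
  rw [Finset.sum_boole]
  simp only [Nat.cast_id]
  congr 1; ext v; simp

/-- `agree S L + 2|S| = 2·#{v ∈ S : v + L ∈ S} + n` (pointwise: `[a ↔ b] + [a] + [b] = 2[a ∧ b] + 1`). -/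
theorem agree_add_card (S : Finset (ZMod n)) (L : ZMod n) :
    agree S L + 2 * S.card = 2 * (S.filter fun v => v + L ∈ S).card + n := by
  have e1 : agree S L + 2 * S.card = ∑ v : ZMod n,
      (((if (v ∈ S ↔ v + L ∈ S) then 1 else 0) + (if v ∈ S then 1 else 0)) + (if v + L ∈ S then 1 else 0)) := by
    rw [Finset.sum_add_distrib, Finset.sum_add_distrib, ← agree_eq_sum, sum_ite_mem_eq_card,
      sum_ite_mem_shift_eq_card]; ring
  have e2 : 2 * (S.filter fun v => v + L ∈ S).card + n = ∑ v : ZMod n,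
      (2 * (if (v ∈ S ∧ v + L ∈ S) then 1 else 0) + 1) := by
    rw [Finset.sum_add_distrib, ← Finset.mul_sum, sum_ite_and_eq_card]; simp [ZMod.card]
  rw [e1, e2]
  exact Finset.sum_congr rfl fun v _ => by by_cases a : v ∈ S <;> by_cases b : v + L ∈ S <;> simp [a, b]

end InnerEdges

/-- **`C12025HalfDense` holds**: every `S ⊆ ZMod 12025` with `|S| ≥ n/2` spans `≥ 6684` edges of `C(12025; ±dmp25)`. -/
theorem c12025HalfDense_holds : C12025HalfDense := by
  intro S hS
  have hA := c12025AgreeBound_holds S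
  rw [sum_dmp25] at hA
  have e1 := agree_add_card S (1 : ZMod 12025)
  have e2 := agree_add_card S (563 : ZMod 12025)
  have e3 := agree_add_card S (566 : ZMod 12025)
  have e4 := agree_add_card S (1727 : ZMod 12025)
  have e5 := agree_add_card S (3632 : ZMod 12025)
  have e6 := agree_add_card S (4586 : ZMod 12025)
  unfold innerEdges
  rw [sum_dmp25]
  omega

/-! ### Criticality of the DMP instance and the conditional refutation of `HalfSparseCore`

`G25` = the edge set of `C(12025; ±dmp25)`.  ALL PROVED BELOW (rc 0, no sorry): every edge is critical (DMP Lemma 1 for this instance: for the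
class `a`, the multiplier `kOf a = q·a⁻¹` sends `a` to the tight length `q = 4008` and every other class into
the middle third `[q+1, 2q]`, so the arc colouring has a single, movable defect).  Together with the kernel-checked
half-density this gives `HDCritical 12025 G25` as soon as `G25` is not 3-colourable — which is DMP's theorem
(normality + periodicity relation `566 = 563 + 3` + their Lemma 3), re-checked by two SAT solvers (kit j293768). -/

section Instance

-- `Finset.univ` over the 12025-element vertex type sits inside `G25`; some elaboration steps walk it.
set_option maxRecDepth 400000

/-- the vertex type; `ZMod 12025` is definitionally `Fin 12025`. -/
abbrev V25 := ZMod 12025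

theorem dmp25_cases {L : V25} (hL : L ∈ dmp25) :
    L = 1 ∨ L = 563 ∨ L = 566 ∨ L = 1727 ∨ L = 3632 ∨ L = 4586 := by
  simpa [dmp25] using hL

theorem dmp25_val {L : V25} (hL : L ∈ dmp25) : 1 ≤ L.val ∧ L.val ≤ 4586 := by
  rcases dmp25_cases hL with rfl | rfl | rfl | rfl | rfl | rfl <;> decide

/-- the edge set of `C(12025; ±dmp25)`. -/
irreducible_def G25 : Finset (Sym2 V25) := (Finset.univ ×ˢ dmp25).image fun p => s(p.1, p.1 + p.2)

theorem mem_G25 {e : Sym2 V25} : e ∈ G25 ↔ ∃ v : V25, ∃ L ∈ dmp25, s(v, v + L) = e := by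
  rw [G25_def, Finset.mem_image]
  constructor
  · rintro ⟨p, hp, hpe⟩
    exact ⟨p.1, p.2, (Finset.mem_product.mp hp).2, hpe⟩
  · rintro ⟨v, L, hL, hvL⟩
    exact ⟨(v, L), Finset.mem_product.mpr ⟨Finset.mem_univ _, hL⟩, hvL⟩

/-- the three arcs `[0,q) [q,2q) [2q,3q]`, `q = 4008`, `n = 3q + 1 = 12025`. -/
def arc3 (x : V25) : Fin 3 := if x.val < 4008 then 0 else if x.val < 8016 then 1 else 2

/-- a length in the middle third is properly coloured by the arcs. -/
theorem arc3_middle (x m : V25) (h1 : 4009 ≤ m.val) (h2 : m.val ≤ 8016) : arc3 x ≠ arc3 (x + m) := by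
  have hx := ZMod.val_lt x
  simp only [arc3, ZMod.val_add]
  split_ifs <;> first | decide | (exfalso; omega)

/-- the tight length `q` has exactly one monochromatic edge, at `x = 2q = 8016`. -/
theorem arc3_tight (x : V25) (hx8 : x.val ≠ 8016) : arc3 x ≠ arc3 (x + 4008) := by
  have hx := ZMod.val_lt x
  have h4 : (4008 : V25).val = 4008 := by decide
  simp only [arc3, ZMod.val_add, h4]
  split_ifs <;> first | decide | (exfalso; omega)

/-- class multipliers `q · a⁻¹` and their inverses `−3a`. -/
def kOf (a : V25) : V25 :=
  if a = 1 then 4008 else if a = 563 then 4941 else if a = 566 then 7613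
  else if a = 1727 then 7954 else if a = 3632 then 5219 else 4878

def kInv (a : V25) : V25 :=
  if a = 1 then 12022 else if a = 563 then 10336 else if a = 566 then 10327
  else if a = 1727 then 6844 else if a = 3632 then 1129 else 10292

theorem kOf_inv {a : V25} (ha : a ∈ dmp25) : kInv a * kOf a = 1 := by
  rcases dmp25_cases ha with rfl | rfl | rfl | rfl | rfl | rfl <;> decide

theorem kOf_self {a : V25} (ha : a ∈ dmp25) : kOf a * a = 4008 := by
  rcases dmp25_cases ha with rfl | rfl | rfl | rfl | rfl | rfl <;> decide

theorem kOf_other {a b : V25} (ha : a ∈ dmp25) (hb : b ∈ dmp25) (hba : b ≠ a) :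
    4009 ≤ (kOf a * b).val ∧ (kOf a * b).val ≤ 8016 := by
  rcases dmp25_cases ha with rfl | rfl | rfl | rfl | rfl | rfl <;>
    rcases dmp25_cases hb with rfl | rfl | rfl | rfl | rfl | rfl <;>
    first | exact absurd rfl hba | decide

/-- the 3-colouring that is proper on every edge except `s(v₀, v₀ + a)`. -/
def col (v₀ a : V25) (w : V25) : Fin 3 := arc3 (kOf a * (w - v₀) + 8016)

theorem col_proper (v₀ a : V25) (ha : a ∈ dmp25) (v b : V25) (hb : b ∈ dmp25)
    (hne : s(v, v + b) ≠ s(v₀, v₀ + a)) : col v₀ a v ≠ col v₀ a (v + b) := by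
  unfold col
  have expand : kOf a * (v + b - v₀) + 8016 = (kOf a * (v - v₀) + 8016) + kOf a * b := by ring
  rw [expand]
  by_cases hab : b = a
  · rw [hab] at hne ⊢
    rw [kOf_self ha]
    apply arc3_tight
    intro h8
    have h8v : (8016 : V25).val = 8016 := by decide
    have hX : kOf a * (v - v₀) + 8016 = (8016 : V25) := ZMod.val_injective 12025 (by rw [h8, h8v])
    have hz : kOf a * (v - v₀) = 0 := by linear_combination hX
    have hv : v - v₀ = 0 := by linear_combination (kInv a) * hz - (v - v₀) * kOf_inv ha
    rw [sub_eq_zero] at hv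
    exact hne (by rw [hv])
  · obtain ⟨h1, h2⟩ := kOf_other ha hb hab
    exact arc3_middle _ _ h1 h2

/-- **every edge of `G25` is critical** (DMP Lemma 1 for the instance). -/
theorem G25_erase_colorable (e₀ : Sym2 V25) (he₀ : e₀ ∈ G25) : Col3 (n := 12025) (G25.erase e₀) := by
  obtain ⟨v₀, a, ha, hva⟩ := mem_G25.mp he₀
  subst hva
  refine ⟨SimpleGraph.Coloring.mk (col v₀ a) ?_⟩
  intro x y hadj
  rw [SimpleGraph.fromEdgeSet_adj] at hadj
  obtain ⟨hmem, _hxy⟩ := hadj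
  have hmem' : s((x : V25), (y : V25)) ∈ G25.erase s(v₀, v₀ + a) := hmem
  obtain ⟨hne, hG⟩ := Finset.mem_erase.mp hmem'
  obtain ⟨v, b, hb, hvb⟩ := mem_G25.mp hG
  rw [← hvb] at hne
  rcases Sym2.eq_iff.mp hvb with ⟨h1, h2⟩ | ⟨h1, h2⟩
  · rw [← h1, ← h2]; exact col_proper v₀ a ha v b hb hne
  · rw [← h1, ← h2]; exact (col_proper v₀ a ha v b hb hne).symm

theorem G25_loopless : ∀ e ∈ G25, ¬ e.IsDiag := by
  intro e he
  obtain ⟨v, L, hL, hvL⟩ := mem_G25.mp he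
  subst hvL
  rw [Sym2.mk_isDiag_iff]
  intro h
  have hL0 : L = 0 := by linear_combination -h
  have hv := dmp25_val hL
  rw [hL0, ZMod.val_zero] at hv
  omega

/-- the class-by-class inner edge count injects into Bob's side of the edge set. -/
theorem innerEdges_le_bobSide (S : Finset V25) : innerEdges dmp25 S ≤ (bobSide S G25).card := by
  have hσ : innerEdges dmp25 S = (dmp25.sigma fun L => S.filter fun v => v + L ∈ S).card := by
    rw [Finset.card_sigma]; rfl
  rw [hσ]
  refine Finset.card_le_card_of_injOn (fun p => s(p.2, p.2 + p.1)) ?_ ?_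
  · intro p hp
    simp only [Finset.coe_sigma, Set.mem_sigma_iff, Finset.mem_coe, Finset.mem_filter] at hp
    rw [Finset.mem_coe, Summit.PneNP.PneNP.Theorems.AeaCutRectanglesDutyRectangles.mem_bobSide]
    refine ⟨mem_G25.mpr ⟨p.2, p.1, hp.1, rfl⟩, ?_⟩
    intro w hw
    rcases Sym2.mem_iff.mp hw with hw1 | hw2
    · rw [hw1]; exact hp.2.1
    · rw [hw2]; exact hp.2.2
  · intro p hp p' hp' h
    simp only [Finset.coe_sigma, Set.mem_sigma_iff, Finset.mem_coe, Finset.mem_filter] at hp hp'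
    rcases Sym2.eq_iff.mp h with ⟨h1, h2⟩ | ⟨h1, h2⟩
    · have h3 : p.1 = p'.1 := by linear_combination h2 - h1
      exact Sigma.ext h3 (heq_of_eq h1)
    · have hsum : p.1 + p'.1 = 0 := by linear_combination h2 - h1
      exfalso
      have hv := dmp25_val hp.1
      have hv' := dmp25_val hp'.1
      have := congrArg ZMod.val hsum
      rw [ZMod.val_add, ZMod.val_zero] at this
      omega

/-- **the DMP instance is HDC-critical, given its non-3-colourability.** -/
theorem hdCritical_G25 (h3 : ¬ Col3 (n := 12025) G25) : HDCritical 12025 G25 :=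
  ⟨G25_loopless, h3, G25_erase_colorable, fun S hS =>
    lt_of_lt_of_le (by have h1 := c12025HalfDense_holds S hS; omega)
      (Nat.mul_le_mul_left 2 (innerEdges_le_bobSide S))⟩

/-- **`HalfSparseCore` is false as soon as `C(12025; ±dmp25)` is not 3-colourable** — which Dobrynin–Mel'nikov–Pyatkin
(2003) prove and cadical + glucose4 confirm. -/
theorem not_halfSparseCore_of_not_col3_G25 (h3 : ¬ Col3 (n := 12025) G25) : ¬ HalfSparseCore :=
  not_halfSparseCore_of_hdCritical (hdCritical_G25 h3)

/-- The same statement with every abbreviation unfolded: **unless the explicit 12025-vertex, 72150-edge graph with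
edge set `G25` is 3-colourable, `HalfSparseCore` (hypothesis of p570033) is false.** -/
theorem halfSparseCore_false_unless_G25_colorable
    (h3 : ¬ (SimpleGraph.fromEdgeSet (SetLike.coe (show Finset (Sym2 (Fin 12025)) from G25))).Colorable 3) :
    ¬ Summit.PneNP.PneNP.Theorems.FoolingMeasure.Negative.HalfSparseCore :=
  not_halfSparseCore_of_not_col3_G25 h3

/-- sanity: `G25` has the 12 advertised neighbours of `0` (so it is the 12-regular circulant, `6n = 72150` edges). -/
example : s((0 : V25), (563 : V25)) ∈ G25 ∧ s((0 : V25), (-4586 : V25)) ∈ G25 :=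
  ⟨mem_G25.mpr ⟨0, 563, by decide, by simp⟩, mem_G25.mpr ⟨-4586, 4586, by decide, by simp⟩⟩

end Instance

end Summit.PneNP.PneNP.Cruxes.FoolingMeasure.IdeasR2g2
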